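import Summits.AtomisticToContinuum.Crystallization.Theorems.OverbindingBudgetStackedRigidityW

/-!
# OverbindingBudget · decomp-a2c lens-4 g31 — part XIX: slot 7c REPAIR OF RECORD R3 «thin tube + registry pinning» (critic row 457), the
reference-centred twin, and the EXISTENCE KERNEL for slot 7d

Helper file under `--supports stmt-AtomisticToContinuum-31280` (RDEF = `Theses.OverbindingBudget.RobustDefectLimitWindows`).  Nothing here
closes RDEF; the file re-types slot 7 of the cone of record (part XVIII, fifteenth form `rdef_of_grossU_shape_gluing_tubeW`), whose slot 7c
`TubeMonotoneW (17/16) η` the census found NUMERICALLY FALSE AS TYPED for every `η ≥ 1/50` (TAG 161, W161.md e8d64cf4: uniform T stack at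
`(b, γ) = (1.03, 0.85)` is clean-W and single-site Nash, yet `λ₁(1/50-ball) = 0.555 <` far mass `1.15`), while ON THE STRESS-FREE LINE the
scalar seam holds at radius `1/50` (margins `+0.18 … +0.93`) and fails from `2/50` on.  Proofs here are re-threading only; the analytic kernel is the companion file
`OverbindingBudgetBalancedReferenceKernel` (same generation).

## §1  R3 of record (critic row 457): thin tube + registry pinning, `(Λ₁; ρ₀, ρ₁) = (17/16; 1/40, 3/16)`
* 7c′ `TubeMonotoneW' Λ₁ ρ₀` — `TubeMonotoneW` WITH the hypotheses `StressFree` + zero transmitted stress across every gap ADDED (WEAKER: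
  `tubeMonotoneW'_of_W`; still exactly what `uniformlyClean_of_tube_reference` consumes, since after slot 7b the configuration HAS zero gap
  stress), at the thin radius `ρ₀`.  [CERT · scalar margin `+0.18` at `1/50`, THIN at `b = 0.90`; fat blockwise (R2, lens-3 g24)]
* 7c″ `RegistryPinningW Λ₁ ρ₀ ρ₁` — ANNULUS EXCLUSION, typed so that it is LOAD-BEARING: a zero-gap-stress uniformly clean stacked reference
  over the same periods whose increments are `ρ₁`-close to those of an admissible zero-gap-stress configuration is in fact `ρ₀`-close
  (no lateral equilibrium offset in the annulus `(ρ₀, ρ₁]`: zero gap stress `= −∇φ(u_m) +` span `≥ 2` terms, `|span ≥ 2| ≤ 0.004 < min |∇φ| =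
  0.069` on the annulus, T rows; S thin `×1.5`).  [CERT · TAG 161 (4) / 161b (ii)]
* 7d `BasalReferenceW Λ₁ ρ₁` at the COARSE radius `ρ₁ ≥` the clean increment tolerance (`0.066`; `ρ₁ = 3/16`), where it is TRUE-type; the seam
  `basalReferenceW_of_pinning : BasalReferenceW Λ₁ ρ₁ → RegistryPinningW Λ₁ ρ₀ ρ₁ → BasalReferenceW Λ₁ ρ₀` (PROVED) is the formal content of
  «7d's TRUE-type condition is discharged by 7c″» — so the `η`-WINDOW IS GONE: `ρ₀` serves the tube data, `ρ₁` serves existence.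
* Seam `basalGapRigidityW_of_tubeW' : TubeMonotoneW' Λ₁ ρ₀ → BasalReferenceW Λ₁ ρ₀ → BasalGapRigidityW Λ₁` (PROVED, part XVIII's pointwise seam).
* ★ Cone SIXTEENTH form `rdef_of_grossU_shape_gluing_pinning_tubeW' Λ Λ₁ ρ₀ ρ₁` (slot 7c/7d := 7c″ ∧ 7c′ ∧ 7d-at-`ρ₁`); the pinning-free
  reading `rdef_of_grossU_shape_gluing_tubeW' Λ Λ₁ ρ₀` (7d asked directly at `ρ₀`) is recorded too.

## §2  The reference-centred twin (same radii; the cert-friendliest binder list, offered to lens-3 g24)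
* `TubeMonotoneRef Λ₁ ρ₀` — the same tube data on the `ρ₀`-tube round a REFERENCE: a `δ`-separated stacked profile over independent periods of
  norm `≤ Λ₁` with ZERO gap stress, UNIFORMLY CLEAN and two-shell-clean (W) layered set — i.e. (after lens-3's stacked dichotomy) a uniform
  T|S registry stack with balanced gaps: exactly the objects of the census's stress-free rows, with the ball centred where `λ₁` was measured.
  CURRENCY-FREE (no host configuration, no `IsNash`).  [CERT · TAG 161 (2): scalar `+0.18` at `1/50`; 161b (i) decides `ρ⋆ ∈ [0.02, 0.04]`]
* `BasalReferenceCW Λ₁ ρ` — `BasalReferenceW` + the reference's `IsCleanW` in the conclusion; NECESSARY-type (`BasalGapRigidityW Λ₁ →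
  BasalReferenceCW Λ₁ ρ` for every `ρ ≥ 0`, PROVED), upgraded `ρ₁ → ρ₀` by the same pinning statement (PROVED).
* Seam `basalGapRigidityW_of_tubeRef` (PROVED: the tube clause is symmetric, both profiles have zero gap stress, part XVIII's kernel on the
  windows `tube w′ ρ₀`) and cone SEVENTEENTH form `rdef_of_grossU_shape_gluing_pinning_tubeRef Λ Λ₁ ρ₀ ρ₁`.

## §3  (companion file `OverbindingBudgetBalancedReferenceKernel`)
The ANALYTIC half of slot 7d — existence (and uniqueness) of the zero-gap-stress profile in the tube round any centre profile with small
residual, from the same tube data (damped contraction on the window product) — is proved in the companion file of this generation.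
-/

noncomputable section

namespace Summit.AtomisticToContinuum.Crystallization.Theorems.OverbindingBudgetStackedRigidityRef

open Metric Filter Topology
open scoped RealInnerProductSpace
open Summit.AtomisticToContinuum.Crystallization.Theses.OverbindingBudget (RobustDefectLimitWindows)
open Summit.AtomisticToContinuum.Crystallization.Theses.PricedLinkCensus (ChargedEnergyGap)
open Summit.AtomisticToContinuum.Crystallization.Theorems.OverbindingBudgetGradedBareness (CleanlessExcessT)
open Summit.AtomisticToContinuum.Crystallization.Theorems.OverbindingBudgetCoherentCut (CoherentResidual)
open Summit.AtomisticToContinuum.Crystallization.Theorems.OverbindingBudgetUniformCutStatements (GrossCleanBallsU)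
open Summit.AtomisticToContinuum.Crystallization.Theorems.OverbindingBudgetElasticSplitScale (CompressedVirialLaw)
open Summit.AtomisticToContinuum.Crystallization.Theorems.OverbindingBudgetElasticSplitShear (StressFree)
open Summit.AtomisticToContinuum.Crystallization.Theorems.ChartedPlanarOrderChunkFloor (E3)
open Summit.AtomisticToContinuum.Crystallization.Theorems.ChartedPlanarOrderRigidityDoor (IsNash)
open Summit.AtomisticToContinuum.Crystallization.Theorems.ChartedPlanarOrderDensityDichotomy (μS IsSep)
open Summit.AtomisticToContinuum.Crystallization.Theorems.ChartedPlanarOrderDoorLayered (Layered)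
open Summit.AtomisticToContinuum.Crystallization.Theorems.ChartedPlanarOrderProfileSlavingLJ (IsStacked gapStress incr tube
  translation_iff_incr_eq)
open Summit.AtomisticToContinuum.Crystallization.Theorems.ChartedPlanarOrderTubeMonotoneSplit (eta_nonneg incr_mem_tube norm_sub_le_two_eta)
open Summit.AtomisticToContinuum.Crystallization.Theorems.OverbindingBudgetPeriodicCleanOrStrained (UniformlyClean)
open Summit.AtomisticToContinuum.Crystallization.Theorems.OverbindingBudgetScaleWidening (IsCleanW DoorPeriodicW)
open Summit.AtomisticToContinuum.Crystallization.Theorems.OverbindingBudgetTwoShellShape (TwoShellShape BarlowGluingW)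
open Summit.AtomisticToContinuum.Crystallization.Theorems.OverbindingBudgetStackedRigidityW (StackedReductionW GapStressVanishesW
  BasalGapRigidityW BasalReferenceW TubeMonotoneW eq_of_equal_stress uniformlyClean_translate layered_add_const uniformlyClean_of_tube_reference
  rdef_of_grossU_shape_gluing_stackedW)

/-! ## §1 R3 of record: thin tube + registry pinning -/

/-- **7c′ · `TubeMonotoneW' Λ ρ`** — `TubeMonotoneW Λ ρ` WITH the hypotheses `StressFree (Layered a b w)` and `∀ m, gapStress a b m (incr w) = 0`
ADDED (WEAKER; its domain is the zero-gap-stress configurations the seam is applied to after slot 7b): scalar tube data — `λ`-strong monotonicity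
of each gap stress in its own increment and the `ℓ¹`-Lipschitz cross-gap bound with `Σκ − κ₀ < λ` — on the `ρ`-tube round the configuration's own
increments.  Why it might fail: the monotone radius round the registry is `ρ⋆ ≈ 0.02–0.03` in scalar typing (TAG 161 (2)); at `ρ = 1/40` the
margin is thin at `b = 0.90` (blockwise re-typing R2 makes it fat). [CERT · census TAG 161/161b] [piece] -/
def TubeMonotoneW' (Λ ρ : ℝ) : Prop :=
  ∀ δ : ℝ, 0 < δ → ∀ (a b : E3) (w : ℤ → E3), ‖a‖ ≤ Λ → ‖b‖ ≤ Λ →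
    IsSep δ (Layered a b w) → IsCleanW (μS (Layered a b w)) → IsNash (μS (Layered a b w)) → IsStacked a b w →
    StressFree (Layered a b w) → (∀ m : ℤ, gapStress a b m (incr w) = 0) →
    ∃ (lam : ℝ) (κ : ℤ → ℝ), (∀ j, 0 ≤ κ j) ∧ Summable κ ∧ Summable (fun j : ℤ => |(j : ℝ)| * κ j) ∧ (∑' j, κ j) - κ 0 < lam ∧
      (∀ m : ℤ, ∀ h : ℤ → E3, (∀ k, h k ∈ tube w ρ k) → ∀ b' ∈ tube w ρ m,
        lam * ‖h m - b'‖ ^ 2 ≤ ⟪gapStress a b m h - gapStress a b m (Function.update h m b'), h m - b'⟫) ∧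
      (∀ m : ℤ, ∀ h h' : ℤ → E3, (∀ k, h k ∈ tube w ρ k) → (∀ k, h' k ∈ tube w ρ k) →
        ‖gapStress a b m h - gapStress a b m h'‖ ≤ ∑' j : ℤ, κ j * ‖h (m + j) - h' (m + j)‖)

/-- **7c″ · `RegistryPinningW Λ₁ ρ₀ ρ₁`** — ANNULUS EXCLUSION (critic row 457 R3, typed load-bearing): for every admissible configuration
(`δ`-separated, clean-W, single-site Nash, stacked over independent periods of norm `≤ Λ₁`, stress-free, zero transmitted stress across every gap)
and every stacked reference over the SAME periods with zero gap stresses and a uniformly clean layered set, if every increment of the reference is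
within `ρ₁` of the configuration's, it is within `ρ₀`.  Mechanism: the layers are exact copies of `ℤa + ℤb`, the reference sits at hollow registry
with balanced heights, and the configuration's zero lateral gap stress `−∇φ(u_m) +` (span `≥ 2` terms `≤ 0.004`) has no solution with lateral
offset in `(ρ₀, ρ₁]` from the hollow (`min |∇φ| = 0.069` there on the T stress-free rows, S `0.049`); heights then agree to second order.  Why it
might fail: S-type pinning margin only `×1.5`; sheared in-plane cells (strain box) untested. [CERT · TAG 161 (4) / 161b (ii)] [piece] -/
def RegistryPinningW (Λ₁ ρ₀ ρ₁ : ℝ) : Prop :=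
  ∀ δ : ℝ, 0 < δ → ∀ (a b : E3) (w : ℤ → E3), IsStacked a b w → LinearIndependent ℝ ![a, b] →
    ‖a‖ ≤ Λ₁ → ‖b‖ ≤ Λ₁ → IsSep δ (Layered a b w) → IsCleanW (μS (Layered a b w)) → IsNash (μS (Layered a b w)) →
    StressFree (Layered a b w) → (∀ m : ℤ, gapStress a b m (incr w) = 0) →
    ∀ w' : ℤ → E3, IsStacked a b w' → (∀ m : ℤ, gapStress a b m (incr w') = 0) → UniformlyClean (Layered a b w') →
      (∀ m : ℤ, incr w' m ∈ tube w ρ₁ m) → ∀ m : ℤ, incr w' m ∈ tube w ρ₀ m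

/-- `TubeMonotoneW Λ ρ → TubeMonotoneW' Λ ρ` (7c′ is WEAKER than the retired 7c). [this file] -/
theorem tubeMonotoneW'_of_W {Λ ρ : ℝ} (h : TubeMonotoneW Λ ρ) : TubeMonotoneW' Λ ρ :=
  fun δ hδ a b w ha hb hs hc hn hst _ _ => h δ hδ a b w ha hb hs hc hn hst

/-- **Seam, PROVED.** Existence at the coarse radius + annulus exclusion ⇒ existence at the thin radius:
`BasalReferenceW Λ₁ ρ₁ → RegistryPinningW Λ₁ ρ₀ ρ₁ → BasalReferenceW Λ₁ ρ₀`. [this file] -/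
theorem basalReferenceW_of_pinning {Λ₁ ρ₀ ρ₁ : ℝ} (hR : BasalReferenceW Λ₁ ρ₁) (hP : RegistryPinningW Λ₁ ρ₀ ρ₁) :
    BasalReferenceW Λ₁ ρ₀ := by
  intro δ hδ a b w hst hab ha hb hs hc hn hf hz
  obtain ⟨w', hst', htube, hz', hUC⟩ := hR δ hδ a b w hst hab ha hb hs hc hn hf hz
  exact ⟨w', hst', hP δ hδ a b w hst hab ha hb hs hc hn hf hz w' hst' hz' hUC htube, hz', hUC⟩

/-- **Seam, PROVED.** `TubeMonotoneW' Λ₁ ρ → BasalReferenceW Λ₁ ρ → BasalGapRigidityW Λ₁` (part XVIII's pointwise seam, re-threaded with the two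
extra hypotheses, which `BasalGapRigidityW` supplies). [this file] -/
theorem basalGapRigidityW_of_tubeW' {Λ₁ ρ : ℝ} (hT : TubeMonotoneW' Λ₁ ρ) (hR : BasalReferenceW Λ₁ ρ) : BasalGapRigidityW Λ₁ := by
  intro δ hδ a b w hst hab ha hb hsep hcl hna hsf hzero
  obtain ⟨w', _hst', htube, hzero', hUC⟩ := hR δ hδ a b w hst hab ha hb hsep hcl hna hsf hzero
  obtain ⟨lam, κ, hκ0, hκs, _hκ1, hdom, hmono, hlip⟩ := hT δ hδ a b w ha hb hsep hcl hna hst hsf hzero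
  exact uniformlyClean_of_tube_reference hκ0 hκs hdom hmono hlip htube (fun m => by rw [hzero m, hzero' m]) hUC

/-- ★ **RDEF cone, SIXTEENTH form — R3 of record** (every `Λ`, `Λ₁`, `ρ₀`, `ρ₁`; of record at `(2, 17/16; 1/40, 3/16)`): the fifteenth with
slot 7c/7d := 7c″ `RegistryPinningW Λ₁ ρ₀ ρ₁` ∧ 7c′ `TubeMonotoneW' Λ₁ ρ₀` ∧ 7d `BasalReferenceW Λ₁ ρ₁` (existence at the COARSE radius). [this file] -/
theorem rdef_of_grossU_shape_gluing_pinning_tubeW' (Λ Λ₁ ρ₀ ρ₁ : ℝ) (hG : GrossCleanBallsU (1 / 250) 10) (hCEG : ChargedEnergyGap)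
    (hC : CompressedVirialLaw (1 / 250) 10) (hS : TwoShellShape (1 / 100) (3 / 50) (1 / 450)) (hB₂ : BarlowGluingW) (hD : DoorPeriodicW Λ)
    (hSR : StackedReductionW Λ Λ₁) (hV : GapStressVanishesW Λ₁) (hP : RegistryPinningW Λ₁ ρ₀ ρ₁) (hT : TubeMonotoneW' Λ₁ ρ₀)
    (hRef : BasalReferenceW Λ₁ ρ₁) (hCE : CleanlessExcessT) (hRes : CoherentResidual 10) : RobustDefectLimitWindows :=
  rdef_of_grossU_shape_gluing_stackedW Λ Λ₁ hG hCEG hC hS hB₂ hD hSR hV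
    (basalGapRigidityW_of_tubeW' hT (basalReferenceW_of_pinning hRef hP)) hCE hRes

/-- **RDEF cone, sixteenth form, pinning-free reading** (7d asked directly at the thin radius `ρ₀`; the critic's literal line-up). [this file] -/
theorem rdef_of_grossU_shape_gluing_tubeW' (Λ Λ₁ ρ₀ : ℝ) (hG : GrossCleanBallsU (1 / 250) 10) (hCEG : ChargedEnergyGap)
    (hC : CompressedVirialLaw (1 / 250) 10) (hS : TwoShellShape (1 / 100) (3 / 50) (1 / 450)) (hB₂ : BarlowGluingW) (hD : DoorPeriodicW Λ)
    (hSR : StackedReductionW Λ Λ₁) (hV : GapStressVanishesW Λ₁) (hT : TubeMonotoneW' Λ₁ ρ₀) (hRef : BasalReferenceW Λ₁ ρ₀)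
    (hCE : CleanlessExcessT) (hRes : CoherentResidual 10) : RobustDefectLimitWindows :=
  rdef_of_grossU_shape_gluing_stackedW Λ Λ₁ hG hCEG hC hS hB₂ hD hSR hV (basalGapRigidityW_of_tubeW' hT hRef) hCE hRes

/-! ## §2 The reference-centred twin -/

/-- **7c‴ · `TubeMonotoneRef Λ₁ ρ`** — the tube data on the `ρ`-tube round a REFERENCE profile: for every `δ`-separated stacked offset profile
`w′` over linearly independent periods of norm `≤ Λ₁` whose layered set is two-shell clean (W) and UNIFORMLY CLEAN and whose transmitted stress
across EVERY gap VANISHES, scalar tube data (`λ`, `κ`) on `tube w′ ρ`.  Currency-free (no host configuration, no `IsNash`); the ball is centred at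
the balanced registry increment, where TAG 161 (2) measured `λ₁`.  Why it might fail: scalar monotone radius `ρ⋆ ≈ 0.02–0.03` (thin at `1/40`;
TAG 161b (i)); blockwise fat. [CERT · INSTRUMENTABLE] [piece] -/
def TubeMonotoneRef (Λ₁ ρ : ℝ) : Prop :=
  ∀ δ : ℝ, 0 < δ → ∀ (a b : E3) (w' : ℤ → E3), IsStacked a b w' → LinearIndependent ℝ ![a, b] → ‖a‖ ≤ Λ₁ → ‖b‖ ≤ Λ₁ →
    IsSep δ (Layered a b w') → IsCleanW (μS (Layered a b w')) → (∀ m : ℤ, gapStress a b m (incr w') = 0) →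
    UniformlyClean (Layered a b w') →
    ∃ (lam : ℝ) (κ : ℤ → ℝ), (∀ j, 0 ≤ κ j) ∧ Summable κ ∧ Summable (fun j : ℤ => |(j : ℝ)| * κ j) ∧ (∑' j, κ j) - κ 0 < lam ∧
      (∀ m : ℤ, ∀ h : ℤ → E3, (∀ k, h k ∈ tube w' ρ k) → ∀ b' ∈ tube w' ρ m,
        lam * ‖h m - b'‖ ^ 2 ≤ ⟪gapStress a b m h - gapStress a b m (Function.update h m b'), h m - b'⟫) ∧
      (∀ m : ℤ, ∀ h h' : ℤ → E3, (∀ k, h k ∈ tube w' ρ k) → (∀ k, h' k ∈ tube w' ρ k) →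
        ‖gapStress a b m h - gapStress a b m h'‖ ≤ ∑' j : ℤ, κ j * ‖h (m + j) - h' (m + j)‖)

/-- **7d″ · `BasalReferenceCW Λ₁ ρ`** — `BasalReferenceW Λ₁ ρ` with the reference's two-shell cleanliness `IsCleanW (μS (Layered a b w′))` added to
the conclusion (the registry reference is two-shell clean with tolerance to spare: a finite pattern check for the 7d prover).  NECESSARY-type
(`basalReferenceCW_of_basalGapRigidityW`). [ANALYTIC ✓ (companion kernel `exists_zeroStress_of_tube_data`) + CERT + METRIC] [piece] -/
def BasalReferenceCW (Λ₁ ρ : ℝ) : Prop :=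
  ∀ δ : ℝ, 0 < δ → ∀ (a b : E3) (w : ℤ → E3), IsStacked a b w → LinearIndependent ℝ ![a, b] →
    ‖a‖ ≤ Λ₁ → ‖b‖ ≤ Λ₁ → IsSep δ (Layered a b w) → IsCleanW (μS (Layered a b w)) → IsNash (μS (Layered a b w)) →
    StressFree (Layered a b w) → (∀ m : ℤ, gapStress a b m (incr w) = 0) →
    ∃ w' : ℤ → E3, IsStacked a b w' ∧ (∀ m : ℤ, incr w' m ∈ tube w ρ m) ∧ (∀ m : ℤ, gapStress a b m (incr w') = 0) ∧
      UniformlyClean (Layered a b w') ∧ IsCleanW (μS (Layered a b w'))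

/-- `BasalReferenceCW → BasalReferenceW` (forget the extra conjunct). [this file] -/
theorem basalReferenceW_of_CW {Λ₁ ρ : ℝ} (h : BasalReferenceCW Λ₁ ρ) : BasalReferenceW Λ₁ ρ := by
  intro δ hδ a b w hst hab ha hb hs hc hn hf hz
  obtain ⟨w', h1, h2, h3, h4, _⟩ := h δ hδ a b w hst hab ha hb hs hc hn hf hz
  exact ⟨w', h1, h2, h3, h4⟩

/-- **NECESSARY-type, PROVED.** `BasalGapRigidityW Λ₁ → BasalReferenceCW Λ₁ ρ` for every `ρ ≥ 0` (witness: the configuration itself). [this file] -/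
theorem basalReferenceCW_of_basalGapRigidityW {Λ₁ ρ : ℝ} (hρ : 0 ≤ ρ) (h : BasalGapRigidityW Λ₁) : BasalReferenceCW Λ₁ ρ := by
  intro δ hδ a b w hst hab ha hb hs hc hn hf hz
  exact ⟨w, hst, fun m => incr_mem_tube hρ m, hz, h δ hδ a b w hst hab ha hb hs hc hn hf hz, hc⟩

/-- **Seam, PROVED.** `BasalReferenceCW Λ₁ ρ₁ → RegistryPinningW Λ₁ ρ₀ ρ₁ → BasalReferenceCW Λ₁ ρ₀`. [this file] -/
theorem basalReferenceCW_of_pinning {Λ₁ ρ₀ ρ₁ : ℝ} (hR : BasalReferenceCW Λ₁ ρ₁) (hP : RegistryPinningW Λ₁ ρ₀ ρ₁) :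
    BasalReferenceCW Λ₁ ρ₀ := by
  intro δ hδ a b w hst hab ha hb hs hc hn hf hz
  obtain ⟨w', hst', htube, hz', hUC, hc'⟩ := hR δ hδ a b w hst hab ha hb hs hc hn hf hz
  exact ⟨w', hst', hP δ hδ a b w hst hab ha hb hs hc hn hf hz w' hst' hz' hUC htube, hz', hUC, hc'⟩

/-- A uniformly clean set is `9/10`-separated (all distances `≥ 0.98·a′ ≥ 0.9212`). [folklore] -/
theorem isSep_of_uniformlyClean {Y : Set E3} (h : UniformlyClean Y) : IsSep (9 / 10) Y := by
  obtain ⟨a', ha1, _ha2, hRT⟩ := h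
  intro x hx y hy hxy
  have hs : (0 : ℝ) < a' * (1 - 1 / 50) - 9 / 10 := by nlinarith
  obtain ⟨_, _, hfar⟩ := hRT x hx (a' * (1 - 1 / 50) - 9 / 10) hs
  have h1 := (hfar y hy (Ne.symm hxy)).1
  linarith

/-- The tube clause is symmetric: `incr w′ m ∈ tube w ρ m → incr w m ∈ tube w′ ρ m`. [folklore] -/
theorem incr_mem_tube_symm {w w' : ℤ → E3} {ρ : ℝ} {m : ℤ} (h : incr w' m ∈ tube w ρ m) : incr w m ∈ tube w' ρ m := by
  rw [tube, mem_closedBall] at h ⊢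
  rwa [dist_comm]

/-- **Pointwise seam, PROVED.** Tube data round the reference `w′` + zero gap stress of both profiles + `incr w′ ∈ tube w ρ` ⇒ `w` is a translate
of `w′`; if `Layered a b w′` is uniformly clean, so is `Layered a b w`. [this file] -/
theorem uniformlyClean_of_reference_tube {a b : E3} {w w' : ℤ → E3} {ρ lam : ℝ} {κ : ℤ → ℝ}
    (hκ0 : ∀ j, 0 ≤ κ j) (hκs : Summable κ) (hdom : (∑' j, κ j) - κ 0 < lam)
    (hmono : ∀ m : ℤ, ∀ h : ℤ → E3, (∀ k, h k ∈ tube w' ρ k) → ∀ b' ∈ tube w' ρ m,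
      lam * ‖h m - b'‖ ^ 2 ≤ ⟪gapStress a b m h - gapStress a b m (Function.update h m b'), h m - b'⟫)
    (hlip : ∀ m : ℤ, ∀ h h' : ℤ → E3, (∀ k, h k ∈ tube w' ρ k) → (∀ k, h' k ∈ tube w' ρ k) →
      ‖gapStress a b m h - gapStress a b m h'‖ ≤ ∑' j : ℤ, κ j * ‖h (m + j) - h' (m + j)‖)
    (htube : ∀ m, incr w' m ∈ tube w ρ m) (hzero : ∀ m, gapStress a b m (incr w) = 0) (hzero' : ∀ m, gapStress a b m (incr w') = 0)
    (hUC : UniformlyClean (Layered a b w')) : UniformlyClean (Layered a b w) := by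
  have htube' : ∀ m, incr w m ∈ tube w' ρ m := fun m => incr_mem_tube_symm (htube m)
  have hρ : 0 ≤ ρ := eta_nonneg htube'
  have hh : ∀ k, incr w' k ∈ tube w' ρ k := fun k => incr_mem_tube hρ k
  have hincr : incr w' = incr w :=
    eq_of_equal_stress hκ0 hκs hdom hmono hlip hh htube' (fun k => norm_sub_le_two_eta hh htube' k)
      (fun m => by rw [hzero m, hzero' m])
  obtain ⟨c, hc⟩ := (translation_iff_incr_eq w' w).mpr fun m => by rw [hincr]
  have hw : w = fun m => w' m + c := funext hc
  rw [hw, layered_add_const]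
  exact uniformlyClean_translate (-c) hUC

/-- **Seam, PROVED.** `TubeMonotoneRef Λ₁ ρ → BasalReferenceCW Λ₁ ρ → BasalGapRigidityW Λ₁`. [this file] -/
theorem basalGapRigidityW_of_tubeRef {Λ₁ ρ : ℝ} (hT : TubeMonotoneRef Λ₁ ρ) (hR : BasalReferenceCW Λ₁ ρ) :
    BasalGapRigidityW Λ₁ := by
  intro δ hδ a b w hst hab ha hb hsep hcl hna hsf hzero
  obtain ⟨w', hst', htube, hzero', hUC, hcl'⟩ := hR δ hδ a b w hst hab ha hb hsep hcl hna hsf hzero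
  obtain ⟨lam, κ, hκ0, hκs, _hκ1, hdom, hmono, hlip⟩ :=
    hT (9 / 10) (by norm_num) a b w' hst' hab ha hb (isSep_of_uniformlyClean hUC) hcl' hzero' hUC
  exact uniformlyClean_of_reference_tube hκ0 hκs hdom hmono hlip htube hzero hzero' hUC

/-- **RDEF cone, SEVENTEENTH form — the reference-centred twin of R3** (every `Λ`, `Λ₁`, `ρ₀`, `ρ₁`): the fifteenth with slot 7c/7d :=
7c″ `RegistryPinningW Λ₁ ρ₀ ρ₁` ∧ 7c‴ `TubeMonotoneRef Λ₁ ρ₀` ∧ 7d″ `BasalReferenceCW Λ₁ ρ₁`. [this file] -/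
theorem rdef_of_grossU_shape_gluing_pinning_tubeRef (Λ Λ₁ ρ₀ ρ₁ : ℝ) (hG : GrossCleanBallsU (1 / 250) 10) (hCEG : ChargedEnergyGap)
    (hC : CompressedVirialLaw (1 / 250) 10) (hS : TwoShellShape (1 / 100) (3 / 50) (1 / 450)) (hB₂ : BarlowGluingW) (hD : DoorPeriodicW Λ)
    (hSR : StackedReductionW Λ Λ₁) (hV : GapStressVanishesW Λ₁) (hP : RegistryPinningW Λ₁ ρ₀ ρ₁) (hT : TubeMonotoneRef Λ₁ ρ₀)
    (hRef : BasalReferenceCW Λ₁ ρ₁) (hCE : CleanlessExcessT) (hRes : CoherentResidual 10) : RobustDefectLimitWindows :=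
  rdef_of_grossU_shape_gluing_stackedW Λ Λ₁ hG hCEG hC hS hB₂ hD hSR hV
    (basalGapRigidityW_of_tubeRef hT (basalReferenceCW_of_pinning hRef hP)) hCE hRes

end Summit.AtomisticToContinuum.Crystallization.Theorems.OverbindingBudgetStackedRigidityRef

end
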